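import Literature.NumberTheory.Transcendental.KZFibredRelations
import Literature.NumberTheory.Transcendental.SemialgebraicMapsProofs

/-!
# Route ValuedFieldSpecialisation — crux `CTConstruction`: dilating the parameter

Helper toward crux stmt-KontsevichZagierPeriods-3495 (`CTConstruction`), line `registered`, stubs
`stub_dilateMap_mem_fibredRelations` and `stub_exists_dilate`. An `(k+1)`-dimensional integral
representation `r` is read as the family `t ↦ r_t` of its slices over the parameter `s = z 0`; the
fibred relations `KZ.fibredRelations = AddSubgroup.closure KZ.fibredGenerators`
(`Literature/NumberTheory/Transcendental/KZFibredRelations.lean`) are generated by the moves of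
the Kontsevich–Zagier calculus applied uniformly in the parameter. For a rational `μ > 0` the
**Jacobian-free dilation** of the parameter replaces `r` by the family `t ↦ r_{μ t}`, i.e. by `r'`
with `r'.domain = D⁻¹(r.domain)`, `r'.integrand = r.integrand ∘ D` for the linear automorphism
`D z = Function.update z 0 (μ * z 0)` (NO factor `μ`).

* `stub_exists_dilate`: such an `r'` exists — preimage of a `ℚ`-semialgebraic set under a
  polynomial map; composite of a semialgebraic function with a semialgebraic map
  (`IsSemialgebraicFunOn.comp_isSemialgebraicMapOn_holds`); integrable by the linear change of
  variables `D_* vol = |det D|⁻¹ vol` (`Measure.map_linearMap_addHaar_eq_smul_addHaar`).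
* `stub_dilateMap_mem_fibredRelations`: reparametrising the base of a fibred chain gives a fibred
  chain — generatorwise (template `KZ.slabMap_mem_fibredRelations`): domain/integrand additivity
  (preimages; the null overlap stays null, `Measure.addHaar_preimage_continuousLinearEquiv`),
  fibred changes of variables (conjugate `Φ̃ = D⁻¹ ∘ Φ ∘ D`, `det Φ̃' = det Φ'` by
  `LinearMap.det_conj`, `Φ̃` still fixes `z 0`), fibred Newton–Leibniz moves (the parameter is a
  base coordinate, `D (Fin.snoc x t) = Fin.snoc (D x) t`: the dilated band is the band over the
  dilated base with bounds `a ∘ D`, `b ∘ D`, primitive `F ∘ D`); then `AddSubgroup.closure_le`.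

Sources: M. Kontsevich, D. Zagier, *Periods* (2001), §1.2 (rules (1)–(3)); J. Bochnak, M. Coste,
M.-F. Roy, *Real Algebraic Geometry* (1998), §2.2 (Prop. 2.2.6). No new definitions; nothing here
about dominated families, slices or constant terms.
-/

noncomputable section

namespace Summit.KontsevichZagierPeriods.ValuedFieldSpecialisation

open MeasureTheory Set Filter MvPolynomial
open Literature.NumberTheory.Transcendental Literature.NumberTheory.Transcendental.KZ
open Literature.ModelTheory.ExponentialFields (IsSemialgebraic isSemialgebraic_univ)

/-! ## The dilation `D z = update z 0 (μ * z 0)` of the parameter coordinate -/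

/-- `FreeAbelianGroup.lift T` on the class `[r] = FreeAbelianGroup.of ⟨n, r⟩` of a representation
is `T ⟨n, r⟩` (`FreeAbelianGroup.lift_apply_of`). [folklore] -/
theorem dilate_lift_of (T : (Σ k, IntegralRep k) → FormalRep) {n : ℕ} (r : IntegralRep n) :
    FreeAbelianGroup.lift T (of r) = T ⟨n, r⟩ :=
  FreeAbelianGroup.lift_apply_of _ _

/-- The dilation `z ↦ update z 0 (c * z 0)` of the parameter coordinate by `c ≠ 0` is a
continuous linear automorphism of `ℝⁿ⁺¹`, with inverse the dilation by `c⁻¹`. [folklore] -/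
theorem exists_dilateEquiv (n : ℕ) {c : ℝ} (hc : c ≠ 0) :
    ∃ L : (Fin (n + 1) → ℝ) ≃L[ℝ] (Fin (n + 1) → ℝ),
      (∀ z, L z = Function.update z 0 (c * z 0)) ∧
        ∀ z, L.symm z = Function.update z 0 (c⁻¹ * z 0) := by
  let e : (Fin (n + 1) → ℝ) ≃ₗ[ℝ] (Fin (n + 1) → ℝ) :=
    { toFun := fun z => Function.update z 0 (c * z 0)
      invFun := fun z => Function.update z 0 (c⁻¹ * z 0)
      map_add' := fun x y => by
        ext i; rcases eq_or_ne i 0 with rfl | hi <;> simp [mul_add, *]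
      map_smul' := fun a x => by
        ext i; rcases eq_or_ne i 0 with rfl | hi <;> simp [mul_left_comm, *]
      left_inv := fun z => by
        ext i; rcases eq_or_ne i 0 with rfl | hi <;> simp [*]
      right_inv := fun z => by
        ext i; rcases eq_or_ne i 0 with rfl | hi <;> simp [*] }
  exact ⟨e.toContinuousLinearEquiv, fun z => rfl, fun z => rfl⟩

/-- The dilation of the parameter coordinate by a rational `μ` is the polynomial map with
coordinates `update X 0 (C μ * X 0)`. [folklore] -/
theorem aeval_dilatePoly {n : ℕ} (μ : ℚ) (z : Fin (n + 1) → ℝ) (j : Fin (n + 1)) :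
    aeval z (Function.update (fun i : Fin (n + 1) => (X i : MvPolynomial (Fin (n + 1)) ℚ)) 0
        (C μ * X 0) j) = Function.update z 0 ((μ : ℝ) * z 0) j := by
  rcases eq_or_ne j 0 with rfl | hj
  · simp
  · simp [hj]

/-- The dilation of the parameter coordinate by a rational `μ` is a `ℚ`-semialgebraic map on
every `ℚ`-semialgebraic set (a polynomial map, `isSemialgebraicMapOn_aeval`).
[Bochnak–Coste–Roy 1998, §2.2] [folklore] -/
theorem isSemialgebraicMapOn_dilate {n : ℕ} {σ : Set (Fin (n + 1) → ℝ)}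
    (hσ : IsSemialgebraic ℚ σ) (μ : ℚ) :
    IsSemialgebraicMapOn ℚ σ (fun z : Fin (n + 1) → ℝ => Function.update z 0 ((μ : ℝ) * z 0)) :=
  (isSemialgebraicMapOn_aeval hσ _).congr fun z _ => funext (aeval_dilatePoly μ z)

/-- The preimage of a `ℚ`-semialgebraic set under the dilation of the parameter coordinate by a
rational `μ` is `ℚ`-semialgebraic (`IsSemialgebraic.preimage_aeval`).
[Bochnak–Coste–Roy 1998, §2.1] [folklore] -/
theorem isSemialgebraic_setOf_dilate_mem {n : ℕ} {σ : Set (Fin (n + 1) → ℝ)}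
    (hσ : IsSemialgebraic ℚ σ) (μ : ℚ) :
    IsSemialgebraic ℚ {z : Fin (n + 1) → ℝ | Function.update z 0 ((μ : ℝ) * z 0) ∈ σ} := by
  have h := hσ.preimage_aeval
    (Function.update (fun i : Fin (n + 1) => (X i : MvPolynomial (Fin (n + 1)) ℚ)) 0 (C μ * X 0))
  have hD : (fun (x : Fin (n + 1) → ℝ) (j : Fin (n + 1)) => aeval x
      (Function.update (fun i : Fin (n + 1) => (X i : MvPolynomial (Fin (n + 1)) ℚ)) 0
        (C μ * X 0) j)) = fun z => Function.update z 0 ((μ : ℝ) * z 0) :=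
    funext fun z => funext (aeval_dilatePoly μ z)
  rw [hD] at h
  exact h

/-- **Linear change of variables for integrability**: if `f` is integrable on `σ` then `f ∘ D` is
integrable on `D⁻¹(σ)` for the dilation `D z = update z 0 (c * z 0)`, `c ≠ 0`
(`D_* vol = |det D|⁻¹ • vol`, `MeasureTheory.Measure.map_linearMap_addHaar_eq_smul_addHaar`,
`MeasurableEmbedding.integrableOn_map_iff`). [folklore] -/
theorem integrableOn_dilate {n : ℕ} {c : ℝ} (hc : c ≠ 0) {f : (Fin (n + 1) → ℝ) → ℝ}
    {σ : Set (Fin (n + 1) → ℝ)} (hf : IntegrableOn f σ volume) :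
    IntegrableOn (fun z => f (Function.update z 0 (c * z 0)))
      {z | Function.update z 0 (c * z 0) ∈ σ} volume := by
  obtain ⟨L, hL, -⟩ := exists_dilateEquiv n hc
  have hmap := Measure.map_linearMap_addHaar_eq_smul_addHaar
    (volume : Measure (Fin (n + 1) → ℝ)) (LinearEquiv.isUnit_det' L.toLinearEquiv).ne_zero
  have hcoe : ⇑L.toLinearEquiv.toLinearMap = ⇑L := rfl
  have h1 : IntegrableOn f σ (Measure.map (⇑L) volume) := by
    rw [← hcoe, hmap, IntegrableOn, Measure.restrict_smul]
    exact hf.integrable.smul_measure ENNReal.ofReal_ne_top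
  have hemb : MeasurableEmbedding (⇑L) := by
    simpa only [ContinuousLinearEquiv.coe_toHomeomorph] using L.toHomeomorph.measurableEmbedding
  have h2 : IntegrableOn (f ∘ ⇑L) (⇑L ⁻¹' σ) volume := hemb.integrableOn_map_iff.mp h1
  have hfun : (f ∘ ⇑L) = fun z => f (Function.update z 0 (c * z 0)) :=
    funext fun z => by rw [Function.comp_apply, hL]
  have hset : ⇑L ⁻¹' σ = {z | Function.update z 0 (c * z 0) ∈ σ} :=
    Set.ext fun z => by rw [mem_preimage, hL, mem_setOf_eq]
  rwa [hfun, hset] at h2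

/-- **Stub `stub_exists_dilate` (D1E).** For a rational `μ > 0` and a family
`r : IntegralRep (k + 1)`, the Jacobian-free dilate `r'` of `r` along the parameter exists:
`r'.domain = {z | update z 0 (μ * z 0) ∈ r.domain}` (preimage under a polynomial map),
`r'.integrand z = r.integrand (update z 0 (μ * z 0))` (semialgebraic as a composite,
`IsSemialgebraicFunOn.comp_isSemialgebraicMapOn_holds`; integrable by `integrableOn_dilate`).
[Kontsevich–Zagier 2001, §1.2; Bochnak–Coste–Roy 1998, Prop. 2.2.6] [folklore] -/
theorem stub_exists_dilate : ∀ (μ : ℚ), 0 < μ → ∀ (k : ℕ) (r : Literature.NumberTheory.Transcendental.KZ.IntegralRep (k + 1)), ∃ r' : Literature.NumberTheory.Transcendental.KZ.IntegralRep (k + 1), r'.domain = {z | Function.update z 0 ((μ : ℝ) * z 0) ∈ r.domain} ∧ r'.integrand = fun z => r.integrand (Function.update z 0 ((μ : ℝ) * z 0)) := by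
  intro μ hμ k r
  have hμ0 : (μ : ℝ) ≠ 0 := by exact_mod_cast hμ.ne'
  have hdom : IsSemialgebraic ℚ
      {z : Fin (k + 1) → ℝ | Function.update z 0 ((μ : ℝ) * z 0) ∈ r.domain} :=
    isSemialgebraic_setOf_dilate_mem r.isSemialgebraic_domain μ
  exact ⟨{ domain := {z | Function.update z 0 ((μ : ℝ) * z 0) ∈ r.domain}
           integrand := fun z => r.integrand (Function.update z 0 ((μ : ℝ) * z 0))
           isSemialgebraic_domain := hdom
           isSemialgebraicFunOn_integrand :=
             IsSemialgebraicFunOn.comp_isSemialgebraicMapOn_holds r.isSemialgebraicFunOn_integrand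
               (isSemialgebraicMapOn_dilate hdom μ) fun z hz => hz
           integrableOn := integrableOn_dilate hμ0 r.integrableOn }, rfl, rfl⟩

/-! ## The dilation commutes with the base/fibre splitting of a band -/

/-- The dilation of the parameter does not see the fibre coordinate of a band:
`D (Fin.snoc x t) = Fin.snoc (D x) t`. [folklore] -/
theorem dilate_snoc {n : ℕ} (c : ℝ) (x : Fin (n + 1) → ℝ) (t : ℝ) :
    Function.update (Fin.snoc x t : Fin (n + 2) → ℝ) 0 (c * (Fin.snoc x t : Fin (n + 2) → ℝ) 0) =
      Fin.snoc (Function.update x 0 (c * x 0)) t := by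
  rw [Fin.snoc_apply_zero, Fin.snoc_update]
  rfl

/-- The base point of a dilated band point is the dilated base point:
`Fin.init (D z) = D (Fin.init z)`. [folklore] -/
theorem init_dilate {n : ℕ} (c : ℝ) (z : Fin (n + 2) → ℝ) :
    Fin.init (Function.update z 0 (c * z 0)) =
      Function.update (Fin.init z) 0 (c * (Fin.init z : Fin (n + 1) → ℝ) 0) := by
  have h : (0 : Fin (n + 2)) = Fin.castSucc (0 : Fin (n + 1)) := rfl
  rw [h, Fin.init_update_castSucc]
  rfl

/-! ## Dilation preserves the four kinds of fibred generators -/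

/-- **Dilating a domain-additivity instance** (dimension `≥ 1`) gives a domain-additivity
instance: the dilated domains are the preimages `D⁻¹(σ) = D⁻¹(σ₁) ∪ D⁻¹(σ₂)`, the null overlap
`σ₁ ∩ σ₂` has null preimage under the linear automorphism `D`
(`MeasureTheory.Measure.addHaar_preimage_continuousLinearEquiv`), and the integrands agree after
composition with `D`. [Kontsevich–Zagier 2001, §1.2 rule (1)] [folklore] -/
theorem dilate_sub_mem_domainAddRel {n : ℕ} {μ : ℚ} (hμ : (μ : ℝ) ≠ 0)
    {r r₁ r₂ s s₁ s₂ : IntegralRep (n + 1)}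
    (hdom : r.domain = r₁.domain ∪ r₂.domain) (hnull : volume (r₁.domain ∩ r₂.domain) = 0)
    (h₁ : EqOn r.integrand r₁.integrand r₁.domain) (h₂ : EqOn r.integrand r₂.integrand r₂.domain)
    (hs : s.domain = {z | Function.update z 0 ((μ : ℝ) * z 0) ∈ r.domain})
    (hsi : s.integrand = fun z => r.integrand (Function.update z 0 ((μ : ℝ) * z 0)))
    (hs₁ : s₁.domain = {z | Function.update z 0 ((μ : ℝ) * z 0) ∈ r₁.domain})
    (hsi₁ : s₁.integrand = fun z => r₁.integrand (Function.update z 0 ((μ : ℝ) * z 0)))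
    (hs₂ : s₂.domain = {z | Function.update z 0 ((μ : ℝ) * z 0) ∈ r₂.domain})
    (hsi₂ : s₂.integrand = fun z => r₂.integrand (Function.update z 0 ((μ : ℝ) * z 0))) :
    of s - of s₁ - of s₂ ∈ domainAddRel := by
  obtain ⟨L, hL, -⟩ := exists_dilateEquiv n hμ
  refine ⟨n + 1, s, s₁, s₂, ?_, ?_, ?_, ?_, rfl⟩
  · rw [hs, hs₁, hs₂, hdom]; rfl
  · have hpre : s₁.domain ∩ s₂.domain = ⇑L ⁻¹' (r₁.domain ∩ r₂.domain) := by
      rw [hs₁, hs₂]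
      ext z
      simp only [mem_inter_iff, mem_setOf_eq, mem_preimage, hL]
    rw [hpre, Measure.addHaar_preimage_continuousLinearEquiv, hnull, mul_zero]
  · intro z hz
    rw [hs₁, mem_setOf_eq] at hz
    simp only [hsi, hsi₁]
    exact h₁ hz
  · intro z hz
    rw [hs₂, mem_setOf_eq] at hz
    simp only [hsi, hsi₂]
    exact h₂ hz

/-- **Dilating an integrand-additivity instance** (dimension `≥ 1`) gives an
integrand-additivity instance: same preimage domain, `(f₁ + f₂) ∘ D = f₁ ∘ D + f₂ ∘ D`.
[Kontsevich–Zagier 2001, §1.2 rule (1)] [folklore] -/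
theorem dilate_sub_mem_integrandAddRel {n : ℕ} (μ : ℚ)
    {r r₁ r₂ s s₁ s₂ : IntegralRep (n + 1)}
    (h₁ : r₁.domain = r.domain) (h₂ : r₂.domain = r.domain)
    (hadd : EqOn r.integrand (r₁.integrand + r₂.integrand) r.domain)
    (hs : s.domain = {z | Function.update z 0 ((μ : ℝ) * z 0) ∈ r.domain})
    (hsi : s.integrand = fun z => r.integrand (Function.update z 0 ((μ : ℝ) * z 0)))
    (hs₁ : s₁.domain = {z | Function.update z 0 ((μ : ℝ) * z 0) ∈ r₁.domain})
    (hsi₁ : s₁.integrand = fun z => r₁.integrand (Function.update z 0 ((μ : ℝ) * z 0)))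
    (hs₂ : s₂.domain = {z | Function.update z 0 ((μ : ℝ) * z 0) ∈ r₂.domain})
    (hsi₂ : s₂.integrand = fun z => r₂.integrand (Function.update z 0 ((μ : ℝ) * z 0))) :
    of s - of s₁ - of s₂ ∈ integrandAddRel := by
  refine ⟨n + 1, s, s₁, s₂, by rw [hs₁, hs, h₁], by rw [hs₂, hs, h₂], ?_, rfl⟩
  intro z hz
  rw [hs, mem_setOf_eq] at hz
  simp only [hsi, hsi₁, hsi₂, Pi.add_apply]
  exact hadd hz

/-- **Dilating a fibred change of variables gives a fibred change of variables.** With `D = L`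
the dilation (a continuous linear automorphism), the dilates `s`, `s'` of `r`, `r'` are related by
the conjugated substitution `Φ̃ = D⁻¹ ∘ Φ ∘ D` on `s.domain = D⁻¹(r.domain)`: `ℚ`-semialgebraic
(`IsSemialgebraicMapOn.comp_holds`), derivative `D⁻¹ ∘L Φ' (D x) ∘L D` within `s.domain` (chain
rule), injective, image `D⁻¹(Φ(r.domain)) = s'.domain`, same Jacobian (`LinearMap.det_conj`), the
integrand identity by unfolding, and `Φ̃ x 0 = μ⁻¹ Φ (D x) 0 = μ⁻¹ μ x 0 = x 0`.
[Kontsevich–Zagier 2001, §1.2 rule (2)] [folklore] -/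
theorem dilate_sub_mem_fibredChangeOfVariablesRel {n : ℕ} {μ : ℚ} (hμ : (μ : ℝ) ≠ 0)
    {r r' s s' : IntegralRep (n + 1)}
    {Φ : (Fin (n + 1) → ℝ) → (Fin (n + 1) → ℝ)}
    {Φ' : (Fin (n + 1) → ℝ) → (Fin (n + 1) → ℝ) →L[ℝ] (Fin (n + 1) → ℝ)}
    (hΦ : IsSemialgebraicMapOn ℚ r.domain Φ)
    (hΦ' : ∀ x ∈ r.domain, HasFDerivWithinAt Φ (Φ' x) r.domain x) (hinj : InjOn Φ r.domain)
    (hdom : r'.domain = Φ '' r.domain)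
    (hf : ∀ x ∈ r.domain, r.integrand x = r'.integrand (Φ x) * |(Φ' x).det|)
    (h0 : ∀ x ∈ r.domain, Φ x 0 = x 0)
    (hs : s.domain = {z | Function.update z 0 ((μ : ℝ) * z 0) ∈ r.domain})
    (hsi : s.integrand = fun z => r.integrand (Function.update z 0 ((μ : ℝ) * z 0)))
    (hs' : s'.domain = {z | Function.update z 0 ((μ : ℝ) * z 0) ∈ r'.domain})
    (hsi' : s'.integrand = fun z => r'.integrand (Function.update z 0 ((μ : ℝ) * z 0))) :
    of s - of s' ∈ fibredChangeOfVariablesRel := by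
  obtain ⟨L, hL, hLs⟩ := exists_dilateEquiv n hμ
  let A : (Fin (n + 1) → ℝ) →L[ℝ] (Fin (n + 1) → ℝ) := L
  let B : (Fin (n + 1) → ℝ) →L[ℝ] (Fin (n + 1) → ℝ) := L.symm
  have hsL : s.domain = ⇑L ⁻¹' r.domain := by
    rw [hs]
    exact Set.ext fun z => by rw [mem_preimage, hL, mem_setOf_eq]
  have hmaps : MapsTo (⇑L) s.domain r.domain := fun z hz => by rwa [hsL] at hz
  have hLalg : IsSemialgebraicMapOn ℚ s.domain (⇑L) :=
    (isSemialgebraicMapOn_dilate s.isSemialgebraic_domain μ).congr fun z _ => (hL z).symm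
  have hLsalg : IsSemialgebraicMapOn ℚ (univ : Set (Fin (n + 1) → ℝ)) (⇑L.symm) := by
    refine (isSemialgebraicMapOn_dilate isSemialgebraic_univ μ⁻¹).congr fun z _ => ?_
    rw [hLs, Rat.cast_inv]
  refine of_sub_of_mem_fibredChangeOfVariablesRel (Φ := fun z => L.symm (Φ (L z)))
    (Φ' := fun z => B.comp ((Φ' (L z)).comp A)) ?_ ?_ ?_ ?_ ?_ ?_
  · exact IsSemialgebraicMapOn.comp_holds hLsalg (IsSemialgebraicMapOn.comp_holds hΦ hLalg hmaps)
      (mapsTo_univ _ _)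
  · intro x hx
    exact L.symm.hasFDerivAt.comp_hasFDerivWithinAt x
      ((hΦ' (L x) (hmaps hx)).comp x L.hasFDerivWithinAt hmaps)
  · intro x hx y hy hxy
    exact L.injective (hinj (hmaps hx) (hmaps hy) (L.symm.injective hxy))
  · rw [hs', hsL]
    ext z
    rw [mem_setOf_eq, ← hL, hdom]
    constructor
    · rintro ⟨y, hy, hyz⟩
      refine ⟨L.symm y, ?_, ?_⟩
      · show L (L.symm y) ∈ r.domain
        rw [L.apply_symm_apply]
        exact hy
      · show L.symm (Φ (L (L.symm y))) = z
        rw [L.apply_symm_apply, hyz, L.symm_apply_apply]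
    · rintro ⟨y, hy, rfl⟩
      show L (L.symm (Φ (L y))) ∈ Φ '' r.domain
      rw [L.apply_symm_apply]
      exact mem_image_of_mem Φ hy
  · intro x hx
    have hdet : (B.comp ((Φ' (L x)).comp A)).det = (Φ' (L x)).det := by
      have hcoe : (B.comp ((Φ' (L x)).comp A)).toLinearMap =
          L.symm.toLinearEquiv.toLinearMap ∘ₗ (Φ' (L x)).toLinearMap ∘ₗ
            L.symm.toLinearEquiv.symm.toLinearMap :=
        LinearMap.ext fun v => rfl
      change LinearMap.det _ = LinearMap.det _
      rw [hcoe, LinearMap.det_conj]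
    simp only [hsi, hsi']
    rw [hdet, ← hL, ← hL, L.apply_symm_apply]
    exact hf (L x) (hmaps hx)
  · intro x hx
    show (L.symm (Φ (L x))) 0 = x 0
    rw [hLs, Function.update_self, h0 (L x) (hmaps hx), hL, Function.update_self,
      inv_mul_cancel_left₀ hμ]

/-- **Dilating a Newton–Leibniz move over a base of dimension `≥ 1` gives such a move**: the
parameter `z 0` is a base coordinate, so with `D` the dilation in dimensions `n + 2` (band) and
`n + 1` (base), `D (Fin.snoc x t) = Fin.snoc (D x) t`, `Fin.init (D z) = D (Fin.init z)`,
`D z (last) = z (last)`; the dilated band is the band over the dilated base with bounds `a ∘ D`,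
`b ∘ D` and primitive `F ∘ D` (semialgebraic as composites), with the same fibrewise continuity,
derivative and boundary identities. [Kontsevich–Zagier 2001, §1.2 rule (3)] [folklore] -/
theorem dilate_sub_mem_newtonLeibnizRel {n : ℕ} (μ : ℚ)
    {r s : IntegralRep (n + 2)} {r' s' : IntegralRep (n + 1)}
    {α β : (Fin (n + 1) → ℝ) → ℝ} {F : (Fin (n + 2) → ℝ) → ℝ}
    (hF : IsSemialgebraicFunOn ℚ r.domain F)
    (hα : IsSemialgebraicFunOn ℚ r'.domain α) (hβ : IsSemialgebraicFunOn ℚ r'.domain β)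
    (hle : ∀ x ∈ r'.domain, α x ≤ β x)
    (hband : r.domain = {z | (Fin.init z : Fin (n + 1) → ℝ) ∈ r'.domain ∧
      α (Fin.init z) ≤ z (Fin.last (n + 1)) ∧ z (Fin.last (n + 1)) ≤ β (Fin.init z)})
    (hcont : ∀ x ∈ r'.domain, ContinuousOn (fun t : ℝ => F (Fin.snoc x t)) (Icc (α x) (β x)))
    (hderiv : ∀ x ∈ r'.domain, ∀ t ∈ Ioo (α x) (β x),
      HasDerivAt (fun s : ℝ => F (Fin.snoc x s)) (r.integrand (Fin.snoc x t)) t)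
    (hr' : ∀ x ∈ r'.domain, r'.integrand x = F (Fin.snoc x (β x)) - F (Fin.snoc x (α x)))
    (hs : s.domain = {z | Function.update z 0 ((μ : ℝ) * z 0) ∈ r.domain})
    (hsi : s.integrand = fun z => r.integrand (Function.update z 0 ((μ : ℝ) * z 0)))
    (hs' : s'.domain = {z | Function.update z 0 ((μ : ℝ) * z 0) ∈ r'.domain})
    (hsi' : s'.integrand = fun z => r'.integrand (Function.update z 0 ((μ : ℝ) * z 0))) :
    of s - of s' ∈ newtonLeibnizRel := by
  have key1 := dilate_snoc (n := n) (μ : ℝ)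
  have key2 := init_dilate (n := n) (μ : ℝ)
  have key3 : ∀ z : Fin (n + 2) → ℝ,
      Function.update z 0 ((μ : ℝ) * z 0) (Fin.last (n + 1)) = z (Fin.last (n + 1)) :=
    fun z => Function.update_of_ne (Fin.last_pos).ne' _ _
  have hmaps : ∀ z ∈ s.domain, Function.update z 0 ((μ : ℝ) * z 0) ∈ r.domain :=
    fun z hz => by rwa [hs, mem_setOf_eq] at hz
  have hmaps' : ∀ x ∈ s'.domain, Function.update x 0 ((μ : ℝ) * x 0) ∈ r'.domain :=
    fun x hx => by rwa [hs', mem_setOf_eq] at hx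
  refine ⟨n + 1, s, s', fun x => α (Function.update x 0 ((μ : ℝ) * x 0)),
    fun x => β (Function.update x 0 ((μ : ℝ) * x 0)),
    fun z => F (Function.update z 0 ((μ : ℝ) * z 0)), ?_, ?_, ?_, ?_, ?_, ?_, ?_, ?_, rfl⟩
  · exact IsSemialgebraicFunOn.comp_isSemialgebraicMapOn_holds hF
      (isSemialgebraicMapOn_dilate s.isSemialgebraic_domain μ) hmaps
  · exact IsSemialgebraicFunOn.comp_isSemialgebraicMapOn_holds hα
      (isSemialgebraicMapOn_dilate s'.isSemialgebraic_domain μ) hmaps'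
  · exact IsSemialgebraicFunOn.comp_isSemialgebraicMapOn_holds hβ
      (isSemialgebraicMapOn_dilate s'.isSemialgebraic_domain μ) hmaps'
  · exact fun x hx => hle _ (hmaps' x hx)
  · rw [hs]
    ext z
    simp only [mem_setOf_eq, hband, hs', key2, key3]
  · intro x hx
    simpa only [key1] using hcont _ (hmaps' x hx)
  · intro x hx t ht
    simpa only [key1, hsi] using hderiv _ (hmaps' x hx) t ht
  · intro x hx
    simp only [hsi', key1]
    exact hr' _ (hmaps' x hx)

/-! ## Assembly: the dilation map preserves fibred relations -/

/-- **Stub `stub_dilateMap_mem_fibredRelations` (D1): reparametrising the base of a fibred chain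
gives a fibred chain.** For a rational `μ > 0` and ANY map `T` on generators of `KZ.FormalRep`
killing dimension `0` and sending each family `⟨k + 1, r⟩` to the class `KZ.of r'` of some
Jacobian-free dilate `r'` of `r` along the parameter (`r'.domain = {z | update z 0 (μ * z 0) ∈
r.domain}`, `r'.integrand z = r.integrand (update z 0 (μ * z 0))`), the additive extension
`FreeAbelianGroup.lift T` maps `KZ.fibredRelations` into itself: by `AddSubgroup.closure_le` it
suffices to treat the four kinds of fibred generators (`dilate_sub_mem_*`; dimension-`0`
additivity instances go to `0`), as in `KZ.slabMap_mem_fibredRelations`.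
[Kontsevich–Zagier 2001, §1.2 rules (1)–(3)] [folklore] -/
theorem stub_dilateMap_mem_fibredRelations : ∀ (μ : ℚ), 0 < μ → ∀ (T : (Σ k, Literature.NumberTheory.Transcendental.KZ.IntegralRep k) → Literature.NumberTheory.Transcendental.KZ.FormalRep), (∀ r : Literature.NumberTheory.Transcendental.KZ.IntegralRep 0, T ⟨0, r⟩ = 0) → (∀ (k : ℕ) (r : Literature.NumberTheory.Transcendental.KZ.IntegralRep (k + 1)), ∃ r' : Literature.NumberTheory.Transcendental.KZ.IntegralRep (k + 1), T ⟨k + 1, r⟩ = Literature.NumberTheory.Transcendental.KZ.of r' ∧ r'.domain = {z | Function.update z 0 ((μ : ℝ) * z 0) ∈ r.domain} ∧ r'.integrand = fun z => r.integrand (Function.update z 0 ((μ : ℝ) * z 0))) → ∀ c ∈ Literature.NumberTheory.Transcendental.KZ.fibredRelations, FreeAbelianGroup.lift T c ∈ Literature.NumberTheory.Transcendental.KZ.fibredRelations := by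
  intro μ hμ T hT0 hfam c hc
  have hμ0 : (μ : ℝ) ≠ 0 := by exact_mod_cast hμ.ne'
  refine (AddSubgroup.closure_le (fibredRelations.comap (FreeAbelianGroup.lift T))).mpr ?_ hc
  rintro c (((hc | hc) | hc) | hc)
  · obtain ⟨k, r, r₁, r₂, hdom, hnull, h₁, h₂, rfl⟩ := hc
    rw [AddSubgroup.coe_comap, mem_preimage, map_sub, map_sub]
    cases k with
    | zero => simp [dilate_lift_of, hT0]
    | succ k =>
      obtain ⟨s, hs, hsd, hsi⟩ := hfam k r
      obtain ⟨s₁, hs₁, hsd₁, hsi₁⟩ := hfam k r₁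
      obtain ⟨s₂, hs₂, hsd₂, hsi₂⟩ := hfam k r₂
      rw [dilate_lift_of, dilate_lift_of, dilate_lift_of, hs, hs₁, hs₂]
      exact mem_fibredRelations_of_mem_domainAddRel
        (dilate_sub_mem_domainAddRel hμ0 hdom hnull h₁ h₂ hsd hsi hsd₁ hsi₁ hsd₂ hsi₂)
  · obtain ⟨k, r, r₁, r₂, h₁, h₂, hadd, rfl⟩ := hc
    rw [AddSubgroup.coe_comap, mem_preimage, map_sub, map_sub]
    cases k with
    | zero => simp [dilate_lift_of, hT0]
    | succ k =>
      obtain ⟨s, hs, hsd, hsi⟩ := hfam k r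
      obtain ⟨s₁, hs₁, hsd₁, hsi₁⟩ := hfam k r₁
      obtain ⟨s₂, hs₂, hsd₂, hsi₂⟩ := hfam k r₂
      rw [dilate_lift_of, dilate_lift_of, dilate_lift_of, hs, hs₁, hs₂]
      exact mem_fibredRelations_of_mem_integrandAddRel
        (dilate_sub_mem_integrandAddRel μ h₁ h₂ hadd hsd hsi hsd₁ hsi₁ hsd₂ hsi₂)
  · obtain ⟨k, r, r', Φ, Φ', hΦ, hΦ', hinj, hdom, hf, h0, rfl⟩ := hc
    obtain ⟨s, hs, hsd, hsi⟩ := hfam k r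
    obtain ⟨s', hs', hsd', hsi'⟩ := hfam k r'
    rw [AddSubgroup.coe_comap, mem_preimage, map_sub, dilate_lift_of, dilate_lift_of, hs, hs']
    exact mem_fibredRelations_of_mem_fibredChangeOfVariablesRel
      (dilate_sub_mem_fibredChangeOfVariablesRel hμ0 hΦ hΦ' hinj hdom hf h0 hsd hsi hsd' hsi')
  · obtain ⟨k, r, r', α, β, F, hF, hα, hβ, hle, hband, hcont, hderiv, hr', rfl⟩ :=
      mem_fibredNewtonLeibnizRel_iff.mp hc
    obtain ⟨s, hs, hsd, hsi⟩ := hfam (k + 1) r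
    obtain ⟨s', hs', hsd', hsi'⟩ := hfam k r'
    have hs2 : T ⟨k + 2, r⟩ = of s := hs
    rw [AddSubgroup.coe_comap, mem_preimage, map_sub, dilate_lift_of, dilate_lift_of, hs2, hs']
    exact mem_fibredRelations_of_mem_fibredNewtonLeibnizRel (of_sub_of_mem_fibredNewtonLeibnizRel
      (dilate_sub_mem_newtonLeibnizRel μ hF hα hβ hle hband hcont hderiv hr' hsd hsi hsd' hsi'))

end Summit.KontsevichZagierPeriods.ValuedFieldSpecialisation
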